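import Summits.CriticalPhenomena.SAWScalingLimit.Theorems.SAWDevelopingMapHexConjectureAvoidanceCocycle
import Summits.CriticalPhenomena.SAWScalingLimit.Theorems.SAWDevelopingMapObservableToSLEFloorPart
import HarnessLib

/-!
# Crux `HexConjecture` (stmt-CriticalPhenomena-0808), line `root-locality-replaces-loewner`,
stub `stub_avoidanceCocycleFloor`: the avoidance cocycle in the FLOOR class

Landing target:
`Summits/CriticalPhenomena/SAWScalingLimit/Theorems/SAWDevelopingMapHexConjectureAvoidanceCocycleFloor.lean`
(`--supports stmt-CriticalPhenomena-0808`).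

Step 3-flat of the composition `HexConjecture_of` of the line skeleton
(`Cruxes/HexConjecture/Lines/root_locality_replaces_loewner.lean`): DCS Conjecture 2
(`HexObservableLimitR`, stmt-CriticalPhenomena-14003) and ROOT DOMINANCE give, for the canonical law
`hexSAWLaw` of the critical hexagonal self-avoiding walk in a FLOOR domain (Jordan domain above the
horizontal line through its two marked points, flat radius-`ρ` half-discs at both marks,
discrete-boundary lattice endpoints) and every hull subdomain `D'`, the Lawler-Schramm-Werner value of
the avoidance probability: `P(range ⊆ closure D') → μ {range ⊆ closure D'}` for the chordal SLE(8/3)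
law `μ`, i.e. `Φ_A'(0)^{5/8}`.

This is a pure composition of two landed theorems:

* `RootLocality.hexAvoidanceCocycle_floor_of_hullApprox` (this line, p113497):
  `HexObservableLimitR → RootDominance → (HA) → ⟨the conclusion⟩`;
* `ObservableToSLE.FloorRatio.hullApprox` (crux stmt-CriticalPhenomena-10472, p114707): the continuum
  hull approximation (HA) — every hull subdomain is swallowed, together with a metric collar, by hull
  subdomains `D''` with `Φ_{A''}'(0)^{5/8} ≤ (1 + ε) Φ_A'(0)^{5/8}`.

* `stub_avoidanceCocycleFloor_hullApprox` — (HA), restated over fully-qualified tree vocabulary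
  (registered helper of the stub);
* `stub_avoidanceCocycleFloor` — the registered stub, verbatim.
-/

noncomputable section

open scoped Topology NNReal ENNReal
open Filter Set Metric MeasureTheory
open Literature.Probability.LatticeModels (HexVertex hexGraph hexCenter)
open Literature.Probability.RandomPlanarGeometry
open Literature.Probability.RandomPlanarGeometry.SAW
open UpperHalfPlane (upperHalfPlaneSet)

namespace Summit.CriticalPhenomena.SAWScalingLimit.Theorems.HexConjecture.RootLocality

/-- **Registered helper `stub_avoidanceCocycleFloor_hullApprox`** (crux item stmt-CriticalPhenomena-0808,
line `root-locality-replaces-loewner`, stub `stub_avoidanceCocycleFloor`): the continuum hull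
approximation (HA) from outside — every hull subdomain `D'` of a Dobrushin domain `D` is approximated by
hull subdomains `D'' ⊇ D'` swallowing a metric collar of `D'` inside `D`, with restriction derivative
`Φ_{A''}'(0)^{5/8} ≤ (1 + ε) Φ_A'(0)^{5/8}`.  This is crux stmt-CriticalPhenomena-10472's landed
`ObservableToSLE.FloorRatio.hullApprox`, by name.
[cite: LawlerSchrammWerner2003Restriction, Lemma 3.5 and its proof (p. 12)] -/
theorem stub_avoidanceCocycleFloor_hullApprox : ∀ (D D' : Literature.Probability.RandomPlanarGeometry.DobrushinDomain), D.IsHullSubdomain D' → ∀ (φ : Literature.Probability.RandomPlanarGeometry.ConformalEquiv UpperHalfPlane.upperHalfPlaneSet D.carrier) (Φ : Literature.Probability.RandomPlanarGeometry.ConformalEquiv (UpperHalfPlane.upperHalfPlaneSet \ φ.pullbackHull D') UpperHalfPlane.upperHalfPlaneSet) (d : ℝ), D.IsChordalUniformizing φ → Literature.Probability.RandomPlanarGeometry.IsRestrictionMap (φ.pullbackHull D') Φ → Literature.Probability.RandomPlanarGeometry.HasRestrictionDeriv (φ.pullbackHull D') Φ d → ∀ ε : ℝ, 0 < ε → ∃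 (D'' : Literature.Probability.RandomPlanarGeometry.DobrushinDomain) (Φ'' : Literature.Probability.RandomPlanarGeometry.ConformalEquiv (UpperHalfPlane.upperHalfPlaneSet \ φ.pullbackHull D'') UpperHalfPlane.upperHalfPlaneSet) (d'' η : ℝ), D.IsHullSubdomain D'' ∧ D'.carrier ⊆ D''.carrier ∧ 0 < η ∧ (∀ z ∈ D.carrier, Metric.infDist z D'.carrier ≤ η → z ∈ D''.carrier) ∧ Literature.Probability.RandomPlanarGeometry.IsRestrictionMap (φ.pullbackHull D'') Φ'' ∧ Literature.Probability.RandomPlanarGeometry.HasRestrictionDeriv (φ.pullbackHull D'') Φ'' d'' ∧ d'' ^ ((5 : ℝ) / 8) ≤ (1 + ε) * d ^ ((5 : ℝ) / 8) :=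
  Summit.CriticalPhenomena.SAWScalingLimit.Theorems.ObservableToSLE.FloorRatio.hullApprox

/-- **Registered stub `stub_avoidanceCocycleFloor`** (crux item stmt-CriticalPhenomena-0808, line
`root-locality-replaces-loewner`): in the FLOOR class, `HexObservableLimitR → RootDominance →` the
avoidance cocycle with the Lawler-Schramm-Werner value — for the canonical law `hexSAWLaw` with
discrete-boundary endpoints approximating the marks and every hull subdomain `D'`, the probability of
`{range ⊆ closure D'}` tends to `μ {range ⊆ closure D'}` for the chordal SLE(8/3) law `μ` in `D`.
Composition of `hexAvoidanceCocycle_floor_of_hullApprox` with (HA).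
[cite: LawlerSchrammWerner2004SAW, §3.4 and Prop. 2] -/
theorem stub_avoidanceCocycleFloor : Summit.CriticalPhenomena.SAWScalingLimit.Theses.SAWDefectDecoherence.HexObservableLimitR → (∀ (D : Literature.Probability.RandomPlanarGeometry.DobrushinDomain) (ρ : ℝ) (Λ Λ' : ℝ → Finset Literature.Probability.LatticeModels.HexVertex) (m : ℝ → ℤ) (a : ℝ → Sym2 Literature.Probability.LatticeModels.HexVertex), 0 < ρ → D.carrier ∩ Metric.ball (D.pt 0) ρ = {z : ℂ | (D.pt 0).im < z.im} ∩ Metric.ball (D.pt 0) ρ → (∀ᶠ δ : ℝ in nhdsWithin (0 : ℝ) (Set.Ioi 0), Literature.Probability.RandomPlanarGeometry.SAW.hexDomainSimplyConnected (Λ δ) ∧ Literature.Probability.RandomPlanarGeometry.SAW.hexDomainSimplyConnected (Λ' δ) ∧ Λ' δ ⊆ Λ δ ∧ a δ ∈ Literature.Probability.RandomPlanarGeometry.SAW.hexDomainBoundary (Λ δ) ∧ a δ ∈ Literature.Probability.RandomPlanarGeometry.SAW.hexDomainBoundary (Λ' δ) ∧ (∀ v ∈ Λ δ, (δ : ℂ)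 * Literature.Probability.LatticeModels.hexCenter v ∈ D.carrier) ∧ (∀ v : Literature.Probability.LatticeModels.HexVertex, (δ : ℂ) * Literature.Probability.LatticeModels.hexCenter v ∈ Metric.ball (D.pt 0) ρ → (v ∈ Λ δ ↔ m δ ≤ v.1 1)) ∧ (∀ v : Literature.Probability.LatticeModels.HexVertex, (δ : ℂ) * Literature.Probability.LatticeModels.hexCenter v ∈ Metric.ball (D.pt 0) ρ → (v ∈ Λ' δ ↔ v ∈ Λ δ))) → Filter.Tendsto (fun δ : ℝ => (δ : ℂ) * Literature.Probability.RandomPlanarGeometry.SAW.hexMidpoint (a δ)) (nhdsWithin (0 : ℝ) (Set.Ioi 0)) (nhds (D.pt 0)) → ∀ ε : ℝ, 0 < ε → ∃ r₀ : ℝ, 0 < r₀ ∧ ∀ r : ℝ, 0 < r → r < r₀ → ∃ ψ : ℂ → ℝ, Continuous ψ ∧ HasCompactSupport ψ ∧ (∀ z, 0 ≤ ψ z) ∧ (∃ z, ψ z ≠ 0) ∧ tsupport ψ ⊆ Metric.ball (D.pt 0 + (r : ℂ) * Complex.I) (r / 4) ∧ ∀ᶠ δ : ℝ in nhdsWithin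 (0 : ℝ) (Set.Ioi 0), ‖(∑ᶠ e ∈ Literature.Probability.RandomPlanarGeometry.SAW.hexDomainMidEdges (Λ' δ), (ψ ((δ : ℂ) * Literature.Probability.RandomPlanarGeometry.SAW.hexMidpoint e) : ℂ) * Literature.Probability.RandomPlanarGeometry.SAW.hexParafermionicObservable (Λ' δ) (a δ) Literature.Probability.RandomPlanarGeometry.SAW.hexCriticalFugacity (5 / 8) e) - ∑ᶠ e ∈ Literature.Probability.RandomPlanarGeometry.SAW.hexDomainMidEdges (Λ δ), (ψ ((δ : ℂ) * Literature.Probability.RandomPlanarGeometry.SAW.hexMidpoint e) : ℂ) * Literature.Probability.RandomPlanarGeometry.SAW.hexParafermionicObservable (Λ δ) (a δ) Literature.Probability.RandomPlanarGeometry.SAW.hexCriticalFugacity (5 / 8) e‖ ≤ ε * ‖∑ᶠ e ∈ Literature.Probability.RandomPlanarGeometry.SAW.hexDomainMidEdges (Λ δ), (ψ ((δ : ℂ) * Literature.Probability.RandomPlanarGeometry.SAW.hexMidpoint e) : ℂ) * Literature.Probability.RandomPlanarGeometry.SAW.hexParafermionicObservable (Λ δ) (a δ) Literature.Probability.RandomPlanarGeometry.SAW.hexCriticalFugacity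 (5 / 8) e‖) → ∀ (D D' : Literature.Probability.RandomPlanarGeometry.DobrushinDomain) (ρ : ℝ) (a b : ℝ → Literature.Probability.LatticeModels.HexVertex) (μ : MeasureTheory.Measure (Literature.Probability.RandomPlanarGeometry.CurveClass ℂ)), (0 < ρ ∧ (D.pt 1).im = (D.pt 0).im ∧ D.carrier ⊆ {z : ℂ | (D.pt 0).im < z.im} ∧ D.carrier ∩ Metric.ball (D.pt 0) ρ = {z : ℂ | (D.pt 0).im < z.im} ∩ Metric.ball (D.pt 0) ρ ∧ D.carrier ∩ Metric.ball (D.pt 1) ρ = {z : ℂ | (D.pt 1).im < z.im} ∩ Metric.ball (D.pt 1) ρ) → Literature.Probability.RandomPlanarGeometry.SAW.IsEmbEndpointApprox Literature.Probability.LatticeModels.hexGraph Literature.Probability.LatticeModels.hexCenter D a b → (∀ᶠ δ : ℝ in nhdsWithin (0 : ℝ) (Set.Ioi 0), (a δ ∈ Literature.Probability.RandomPlanarGeometry.SAW.embMeshDomain Literature.Probability.LatticeModels.hexGraph Literature.Probability.LatticeModels.hexCenter D.carrier δ ∧ ∃ w, Literature.Probability.LatticeModels.hexGraph.Adj (a δ)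 w ∧ ¬ (Literature.Probability.RandomPlanarGeometry.SAW.hexDomainGraph D.carrier δ).Adj (a δ) w) ∧ (b δ ∈ Literature.Probability.RandomPlanarGeometry.SAW.embMeshDomain Literature.Probability.LatticeModels.hexGraph Literature.Probability.LatticeModels.hexCenter D.carrier δ ∧ ∃ w, Literature.Probability.LatticeModels.hexGraph.Adj (b δ) w ∧ ¬ (Literature.Probability.RandomPlanarGeometry.SAW.hexDomainGraph D.carrier δ).Adj (b δ) w)) → D.IsHullSubdomain D' → Literature.Probability.RandomPlanarGeometry.IsSLELaw ((8 : NNReal) / 3) D μ → Filter.Tendsto (fun δ : ℝ => ((Literature.Probability.RandomPlanarGeometry.SAW.hexSAWLaw D.carrier δ (a δ) (b δ)).map (fun γ : Literature.Probability.RandomPlanarGeometry.SAW.HexDomainSAW D.carrier δ (a δ) (b δ) => γ.curve)) (Literature.Probability.RandomPlanarGeometry.CurveClass.rangeSubset (closure D'.carrier))) (nhdsWithin (0 : ℝ) (Set.Ioi 0)) (nhds (μ (Literature.Probability.RandomPlanarGeometry.CurveClass.rangeSubset (closure D'.carrier)))) :=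
  fun hO hRD => hexAvoidanceCocycle_floor_of_hullApprox hO hRD stub_avoidanceCocycleFloor_hullApprox

end Summit.CriticalPhenomena.SAWScalingLimit.Theorems.HexConjecture.RootLocality

end
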